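import Literature.NumberTheory.Rogawski1990.WeylVanishingSplitNonRegularNull   -- ★ the W1s road, last brick: conullity + the split vanishing theorem
import HarnessLib

/-!
# F0 · P3b · line «CMCharIdentityTest» — (W1s) `stub_weylVanishingSplit`: the Weyl vanishing theorem for `H_v` at a split place

Cell `pub/hodgecm-mathlib`, crux H413 = `stmt-HodgeConjecture-24833`, route HCCMUnconditional; desk F0P3b-plan (g13), ED. 15 of the tree
line `Cruxes/H413/Lines/F0_P3b_CMCharIdentityTestPaydown.lean` (:462 `stub_weylVanishingSplit`); pen F0P3b-p01 (g8).  THEOREMS ONLY,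
sorry-free.  HONEST LABEL: HC_CM is proved only modulo the 2 remaining named inputs (hLiu418, h413) until rung 0 closes; this file
closes the ANALYSIS brick (W1s) of the P3b line and discharges no named input of the summit.

THE STATEMENT (W1s, verbatim = the stub's Π-type with the line's `abbrev`s `Pl`, `HLoc` unfolded): at a place `v` of `L⁺` split in `L`,
for a Haar measure `νH` on `H_v = U(Φ₂)(L⁺_v) × U(Φ₁)(L⁺_v)` (Borel quotient σ-algebras on the `H_v ∕ Z(a)`), a CANONICAL orbital measure
family `mH` for the `G`-regular classes (★ `OrbitalMeasureFamily.IsCanonical (IsLocalGRegular L v) νH`) and a test function `g`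
(★ `IsLocSmooth`: locally constant, compactly supported) all of whose `G`-regular class orbital integrals vanish, `∫ g dνH = 0`.

THE PROOF — the road «W1s soft Weyl» (Harish-Chandra's Lemma 41∕42 WITHOUT a Jacobian): ★ `FibreCountPullback` (Federer multiplicity
pull-back of Haar along the conjugation family) → ★ `ConjugationFamilyFibres` ∕ ★ `ConjugationWeylVanishing` (local injectivity, fibre
count `|N(T)∕T|`, Weil relative uniqueness, vanishing per torus, gluing) → ★ `WeylVanishingCanonical` (generic canonical-family theorem) →
★ `RegularSemisimpleCentralizerGL` ∕ ★ `RegularTorusSaturationOpen` (matrix-level torus axioms) → ★ `WeylVanishingSplitTorusAxioms`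
(docking on the letter's carriers, modulo conullity) → ★ `WeylVanishingSplitNonRegularNull` (conullity of the `G`-regular set by torus
averaging, ★ `TranslateAveragingNull`; the split vanishing theorem `integral_eq_zero_of_forall_classOrbitalIntegral_eq_zero_split`).
This file is the one-line fold: **`weylVanishingSplit`** (= the stub; closes it by `exact`).
-/

set_option autoImplicit false
set_option linter.dupNamespace false

noncomputable section

open MeasureTheory Measure NumberField IsDedekindDomain
open scoped Matrix MatrixGroups
open Literature.NumberTheory.Rogawski1990 Literature.NumberTheory.Automorphic Literature.NumberTheory.Automorphic.UnitaryGroup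

namespace Summit.HodgeConjecture.HodgeConjecture.Cruxes.H413.F0P3bWeylVanishingSplit

set_option synthInstance.maxHeartbeats 200000 in
/-- **(W1s) = `stub_weylVanishingSplit` — the Weyl vanishing theorem for `H_v = U(Φ₂)(L⁺_v) × U(Φ₁)(L⁺_v)` at a split place**: for `v`
split in `L`, a Haar measure `νH` on `H_v`, a canonical orbital measure family `mH` for the `G`-regular classes and a locally constant
compactly supported `g` whose `G`-regular class orbital integrals all vanish, `∫ g dνH = 0`.  ★
`integral_eq_zero_of_forall_classOrbitalIntegral_eq_zero_split` (Weyl integration formula restricted to the conull `G`-regular set, as a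
vanishing statement). [cite: HarishChandra1970, Lemma 42] [cite: Rogawski1990, §12.5 p. 182] -/
theorem weylVanishingSplit :
  ∀ (L : Type) [Field L] [NumberField L] [IsCMField L] (v : HeightOneSpectrum (𝓞 ↥(maximalRealSubfield L))),
    (∃ w : PlacesOver L v, IsCMField.complexConj L • w.1 ≠ w.1) →
    ∀ [MeasurableSpace ((UnitaryGroup.cmDatum L 2 (Matrix.of fun i j : Fin 2 => if i.val + j.val + 1 = 2 then (1 : L) else 0)).Local v ×
        (UnitaryGroup.cmDatum L 1 (Matrix.of fun i j : Fin 1 => if i.val + j.val + 1 = 1 then (1 : L) else 0)).Local v)] [BorelSpace ((UnitaryGroup.cmDatum L 2 (Matrix.of fun i j : Fin 2 => if i.val + j.val + 1 = 2 then (1 : L) else 0)).Local v ×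
        (UnitaryGroup.cmDatum L 1 (Matrix.of fun i j : Fin 1 => if i.val + j.val + 1 = 1 then (1 : L) else 0)).Local v)] (νH : Measure ((UnitaryGroup.cmDatum L 2 (Matrix.of fun i j : Fin 2 => if i.val + j.val + 1 = 2 then (1 : L) else 0)).Local v ×
        (UnitaryGroup.cmDatum L 1 (Matrix.of fun i j : Fin 1 => if i.val + j.val + 1 = 1 then (1 : L) else 0)).Local v)) [νH.IsHaarMeasure] [νH.IsMulRightInvariant],
    letI : ∀ a : ((UnitaryGroup.cmDatum L 2 (Matrix.of fun i j : Fin 2 => if i.val + j.val + 1 = 2 then (1 : L) else 0)).Local v ×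
        (UnitaryGroup.cmDatum L 1 (Matrix.of fun i j : Fin 1 => if i.val + j.val + 1 = 1 then (1 : L) else 0)).Local v), MeasurableSpace (((UnitaryGroup.cmDatum L 2 (Matrix.of fun i j : Fin 2 => if i.val + j.val + 1 = 2 then (1 : L) else 0)).Local v ×
        (UnitaryGroup.cmDatum L 1 (Matrix.of fun i j : Fin 1 => if i.val + j.val + 1 = 1 then (1 : L) else 0)).Local v) ⧸ Subgroup.centralizer ({a} : Set ((UnitaryGroup.cmDatum L 2 (Matrix.of fun i j : Fin 2 => if i.val + j.val + 1 = 2 then (1 : L) else 0)).Local v ×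
        (UnitaryGroup.cmDatum L 1 (Matrix.of fun i j : Fin 1 => if i.val + j.val + 1 = 1 then (1 : L) else 0)).Local v))) := fun _ => borel _
    haveI : ∀ a : ((UnitaryGroup.cmDatum L 2 (Matrix.of fun i j : Fin 2 => if i.val + j.val + 1 = 2 then (1 : L) else 0)).Local v ×
        (UnitaryGroup.cmDatum L 1 (Matrix.of fun i j : Fin 1 => if i.val + j.val + 1 = 1 then (1 : L) else 0)).Local v), BorelSpace (((UnitaryGroup.cmDatum L 2 (Matrix.of fun i j : Fin 2 => if i.val + j.val + 1 = 2 then (1 : L) else 0)).Local v ×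
        (UnitaryGroup.cmDatum L 1 (Matrix.of fun i j : Fin 1 => if i.val + j.val + 1 = 1 then (1 : L) else 0)).Local v) ⧸ Subgroup.centralizer ({a} : Set ((UnitaryGroup.cmDatum L 2 (Matrix.of fun i j : Fin 2 => if i.val + j.val + 1 = 2 then (1 : L) else 0)).Local v ×
        (UnitaryGroup.cmDatum L 1 (Matrix.of fun i j : Fin 1 => if i.val + j.val + 1 = 1 then (1 : L) else 0)).Local v))) := fun _ => ⟨rfl⟩
    ∀ (mH : OrbitalMeasureFamily ((UnitaryGroup.cmDatum L 2 (Matrix.of fun i j : Fin 2 => if i.val + j.val + 1 = 2 then (1 : L) else 0)).Local v ×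
        (UnitaryGroup.cmDatum L 1 (Matrix.of fun i j : Fin 1 => if i.val + j.val + 1 = 1 then (1 : L) else 0)).Local v)), mH.IsCanonical (IsLocalGRegular L v) νH →
      ∀ (g : ((UnitaryGroup.cmDatum L 2 (Matrix.of fun i j : Fin 2 => if i.val + j.val + 1 = 2 then (1 : L) else 0)).Local v ×
        (UnitaryGroup.cmDatum L 1 (Matrix.of fun i j : Fin 1 => if i.val + j.val + 1 = 1 then (1 : L) else 0)).Local v) → ℂ), IsLocSmooth g →
        (∀ a : ((UnitaryGroup.cmDatum L 2 (Matrix.of fun i j : Fin 2 => if i.val + j.val + 1 = 2 then (1 : L) else 0)).Local v ×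
        (UnitaryGroup.cmDatum L 1 (Matrix.of fun i j : Fin 1 => if i.val + j.val + 1 = 1 then (1 : L) else 0)).Local v), IsLocalGRegular L v a → classOrbitalIntegral mH g (ConjClasses.mk a) = 0) →
        ∫ h, g h ∂νH = 0 := by
  intro L _ _ _ v hs _ _ νH _ _ mH hmH g hg h0
  letI : ∀ a : ((UnitaryGroup.cmDatum L 2 (Matrix.of fun i j : Fin 2 => if i.val + j.val + 1 = 2 then (1 : L) else 0)).Local v ×
        (UnitaryGroup.cmDatum L 1 (Matrix.of fun i j : Fin 1 => if i.val + j.val + 1 = 1 then (1 : L) else 0)).Local v), MeasurableSpace (((UnitaryGroup.cmDatum L 2 (Matrix.of fun i j : Fin 2 => if i.val + j.val + 1 = 2 then (1 : L) else 0)).Local v ×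
        (UnitaryGroup.cmDatum L 1 (Matrix.of fun i j : Fin 1 => if i.val + j.val + 1 = 1 then (1 : L) else 0)).Local v) ⧸ Subgroup.centralizer ({a} : Set ((UnitaryGroup.cmDatum L 2 (Matrix.of fun i j : Fin 2 => if i.val + j.val + 1 = 2 then (1 : L) else 0)).Local v ×
        (UnitaryGroup.cmDatum L 1 (Matrix.of fun i j : Fin 1 => if i.val + j.val + 1 = 1 then (1 : L) else 0)).Local v))) := fun _ => borel _
  haveI : ∀ a : ((UnitaryGroup.cmDatum L 2 (Matrix.of fun i j : Fin 2 => if i.val + j.val + 1 = 2 then (1 : L) else 0)).Local v ×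
        (UnitaryGroup.cmDatum L 1 (Matrix.of fun i j : Fin 1 => if i.val + j.val + 1 = 1 then (1 : L) else 0)).Local v), BorelSpace (((UnitaryGroup.cmDatum L 2 (Matrix.of fun i j : Fin 2 => if i.val + j.val + 1 = 2 then (1 : L) else 0)).Local v ×
        (UnitaryGroup.cmDatum L 1 (Matrix.of fun i j : Fin 1 => if i.val + j.val + 1 = 1 then (1 : L) else 0)).Local v) ⧸ Subgroup.centralizer ({a} : Set ((UnitaryGroup.cmDatum L 2 (Matrix.of fun i j : Fin 2 => if i.val + j.val + 1 = 2 then (1 : L) else 0)).Local v ×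
        (UnitaryGroup.cmDatum L 1 (Matrix.of fun i j : Fin 1 => if i.val + j.val + 1 = 1 then (1 : L) else 0)).Local v))) := fun _ => ⟨rfl⟩
  exact integral_eq_zero_of_forall_classOrbitalIntegral_eq_zero_split L v hs νH mH hmH g hg h0

end Summit.HodgeConjecture.HodgeConjecture.Cruxes.H413.F0P3bWeylVanishingSplit

end
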